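import Summits.CriticalPhenomena.SAWScalingLimit.Theses.SAWExcursionCardy
import Summits.CriticalPhenomena.SAWScalingLimit.Theorems.SAWRenewalTightnessTightIdentificationGlue

/-!
# Route `SAWExcursionCardy`: the assembly frame

Item `stmt-CriticalPhenomena-5565` (`Assembly : ExcursionCardyFormula → SlitExcursionCardy →
SimpleSubseqLimits → DrivingIdentification → EventualTight → SAWScalingLimit`).

Pure logic down to the last step. `DrivingIdentification` is the implication
`SlitExcursionCardy → SimpleSubseqLimits → SubseqIdentification` with its last two members inlined
verbatim (syntactically the bodies of the decls `SimpleSubseqLimits` and `SubseqIdentification`),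
so applied to the slit Cardy–Fomin formula and to the simplicity of subsequential limits it yields
`SubseqIdentification`: every subsequential weak limit of the critical SAW laws that is a
probability measure is the chordal SLE_{8/3} law. For each Dobrushin domain with an endpoint
approximation, `EventualTight` is tightness along the mesh (`IsTightAlongMesh`) of the pushed SAW
curve laws, and the tree's PROVED Prokhorov/Billingsley criterion for the SAW,
`saw_convergesInLawToSLE_of_isTightAlongMesh` (`SAWRenewalTightnessTightIdentificationGlue.lean`:
the laws are probability measures for all small `δ`, the curve observable is measurable,
uniqueness of the chordal SLE_{8/3} law), fed with `SubseqIdentification` read through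
`IsSubseqLimitLaw`, gives `ConvergesInLawToSLE (8/3)`, i.e. the conjunct `SAWScalingLimit`
(`= Literature.Probability.RandomPlanarGeometry.SAW.SAWScalingLimit`) unfolded. The headline crux
`ExcursionCardyFormula` (the `η = nil` case of `SlitExcursionCardy`) is carried, not consumed.
No named fact is used; axioms are the standard three.

## References

* P. Billingsley, *Convergence of Probability Measures*, 2nd ed. (1999), Thm. 5.1 and its
  Corollary [BillingsleyCPM1999].
-/

noncomputable section

namespace Summit.CriticalPhenomena.SAWScalingLimit.Theorems

open Summit.CriticalPhenomena.SAWScalingLimit.Theses.SAWExcursionCardy in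
/-- **Item `stmt-CriticalPhenomena-5565` (`SAWExcursionCardy.Assembly`):
`ExcursionCardyFormula → SlitExcursionCardy → SimpleSubseqLimits → DrivingIdentification →
EventualTight → SAWScalingLimit`.** `DrivingIdentification` applied to `SlitExcursionCardy` and
`SimpleSubseqLimits` is `SubseqIdentification` (its inlined hypotheses are the decls verbatim);
then for each `(D, a, b)` with `IsEndpointApprox` the SAW convergence criterion
`saw_convergesInLawToSLE_of_isTightAlongMesh` with tightness `EventualTight D a b hab` and the
subsequential limit laws identified by `SubseqIdentification`. `ExcursionCardyFormula` is the
logically redundant headline hypothesis. [cite: BillingsleyCPM1999, Thm. 5.1, Corollary] -/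
theorem sawExcursionCardy_assembly_proof :
    Summit.CriticalPhenomena.SAWScalingLimit.Theses.SAWExcursionCardy.Assembly := by
  unfold Summit.CriticalPhenomena.SAWScalingLimit.Theses.SAWExcursionCardy.Assembly
  intro _hHeadline hN hS hDI hT D a b hab
  have hI : SubseqIdentification := hDI hN hS
  refine saw_convergesInLawToSLE_of_isTightAlongMesh hab (hT D a b hab) ?_
  rintro μ hμ ⟨s, hs, hlim⟩
  exact hI D a b hab s μ hs hμ hlim

end Summit.CriticalPhenomena.SAWScalingLimit.Theorems

end
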